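import Summits.BirchSwinnertonDyer.BirchSwinnertonDyer.Theorems.AdditiveBranchIMCTwistFieldBaseChange
import Summits.BirchSwinnertonDyer.BirchSwinnertonDyer.Theorems.AdditiveBranchIMCTwistFieldReduction
import Summits.BirchSwinnertonDyer.Rank1Residual.Additive.GordChiBranchKatoComponent
import HarnessLib

/-!
# Crux `GordTwoRankZeroOffCaseOne` (route `AdditiveBranchIMC`, item 19357), lane k1-c2x gen 2: the
# twist-field road in DESCENDED shape — Part 2: the pair-level Λ-adic currencies at ANY image;
# gen 0's integral K-level input ⟹ the descended input; the rational «no free lunch»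

Sequel of `…TwistFieldBaseChange` (Part 1: slack lemma, rational and integral branch containment per
datum). Cell `bsd-addord`, seat `bsd-addord-k1-c2x`. Route-independent (no `Theses` import). HONEST
FRAMING: theorems only; every published input is a DISPLAYED named-fact binder (Kato 2004 Thm. 17.4
`kato_divisibility` — clauses (1)(2) only, NO image hypothesis; Rohrlich 1984 `padicLFunction_ne_zero`);
torsion of `X(W/ℚ_∞)` for cyclotomic data is displayed (`hT`, the reading [C]); boundedness of
`𝓛 = L_p(f,α,T)·ϖ·L_p^{[−]}(f,α,ω^{(p−1)/2},T)` is displayed (`MemIwasawaRat`, Mazur–Tate–Teitelbaum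
§I.12–I.13); the descended product bound `GordTwistBaseChangeLower{Even,Odd}At W p` and gen 0's
`TwistFieldLowerDivisibility{Even,Odd}At V p` are this lane's typed CONJECTURES — nothing is asserted about
them; the unit coefficient is a displayed per-pair CERTIFICATE; nothing is booked; BSD is not proved by
any of this.

* §4 **`chiBranchLowerDivisibilityAt_of_baseChange_of_hasUnitContent`** (+ odd): the typed Λ-adic inputs
  `ChiBranchLowerDivisibility[Odd]At W p` of items 19497/19498 AT THE PAIR `(W, p)`, for ANY image of
  `ρ̄_{W,p}`, from (BC-Gord), Kato (1)(2), Rohrlich, `hT`, and ONE unit coefficient of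
  `ϖ·L_p^{[−]}(f, α, ω^{(p−1)/2}, T)` for the twist models. Compare gen 0's
  `chiBranchLowerDivisibilityAt_of_twistField_of_towerSurj` (image hypothesis, Kato (3)). Consumers: the
  rank-`0` doors of `…TwistFieldBaseChangeDoors` (via k1-c2's p418190 §2).
* §6 `gordTwistBaseChangeLower{Even,Odd}At_of_twistField[Odd]` — gen 0's integral K-level input IMPLIES
  the descended one, by realising `K ⊂ ℚ(ζ_p)`, normalising the generator into `Gal(ℚ̄/K)`
  (additive-p1) and the product formula `charIdeal_towerDual_eq_mul`; and
  `C_pow_mul_mem_span_of_rational_lower` — the rational «no free lunch»: the product clause of (BC-Gord)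
  ⟸ a rational Skinner–Urban containment for `V` ∧ a rational branch containment for `W` ∧ boundedness.
  As in gen 0: the input re-bases the missing theorem, it does not shrink it.

References: K. Kato, Astérisque 295 (2004) Thm. 17.4 [Kato2004Asterisque]; D. Rohrlich, Invent. Math. 75
(1984) [RohrlichInventiones1984]; R. Greenberg, LNM 1716 (1999) §1, §5 [GreenbergLNM1716];
Mazur–Tate–Teitelbaum, Invent. Math. 84 (1986) §I.12–I.14 [MazurTateTeitelbaum1986Invent];
Burungale–Castella–Skinner, IMRN 2025 §5 (5.3) [BurungaleCastellaSkinner2025]; Skinner–Urban, Invent.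
Math. 195 (2014) Cor. 3.6.3 [SkinnerUrban2014]; Greenberg–Vatsal 2000 p. 2 (2) [GreenbergVatsal2000].
-/

set_option autoImplicit false
set_option linter.dupNamespace false

noncomputable section

open scoped Classical MatrixGroups ModularForm

open CongruenceSubgroup WeierstrassCurve Literature.NumberTheory.EllipticCurves
  Literature.NumberTheory.EllipticCurves.ModularForms
  Literature.NumberTheory.EllipticCurves.Rank1Residual
  Literature.NumberTheory.EllipticCurves.Rank1Residual.Typed
  Literature.NumberTheory.GaloisRepresentations
  Literature.NumberTheory.EllipticCurves.GreenbergVatsal2000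

namespace Summit.BirchSwinnertonDyer.BirchSwinnertonDyer.Theorems.AdditiveBranchIMCTwistField

open Summit.BirchSwinnertonDyer.Rank1Residual.Additive
open Summit.BirchSwinnertonDyer.Rank1Residual.Additive (TowerSelmerDualData towerSelmerDualData
  isCyclotomicVariable_mul_of_mem_kerSubgroup)
open Summit.BirchSwinnertonDyer.Rank1Residual.AdditivePotMult (exists_mul_mem_galRange
  isTopGenerator_mul_of_mem_kerSubgroup conjH1_mul_of_mem_kerSubgroup)

/-! ## §4 Pair level: the typed Λ-adic inputs of items 19497/19498 at ANY image, modulo the certificate -/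

section Currency

variable {W : WeierstrassCurve ℚ} {p : ℕ} [hp : Fact p.Prime]

/-- **`ChiBranchLowerDivisibilityAt W p` (item 19497's input at the pair `(W, p)`) from the descended
twist-field road, for ANY image of `ρ̄_{W,p}`**: GIVEN, displayed — Kato's `kato_divisibility` for the
good ordinary twist models `V` of `W` (Thm. 17.4; only clauses (1) torsion and (2) RATIONAL divisibility
are used — NO image hypothesis), Rohrlich's `padicLFunction_ne_zero`, torsion of `X(W/ℚ_∞)` for
cyclotomic data (reading [C], displayed as `hT`), the descended product bound
`GordTwistBaseChangeLowerEvenAt W p` (this lane's typed conjecture, NOT in print), and the finite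
certificate `hU`: for every good ordinary twist model `V`, newform `f`, `ϖ·Ω_V = Ω⁺_f`, the series
`ϖ·L_p(f, α, ω^{(p−1)/2}, T)` is `ι b` with ONE unit coefficient. Compare `…TwistFieldItems`
(`chiBranchLowerDivisibilityAt_of_twistField_of_towerSurj`): there the image hypothesis (Kato (3)); here
a `μ`-certificate instead. [cite: Kato2004Asterisque, Thm. 17.4 (1)(2) (p. 273)]
[cite: RohrlichInventiones1984, Theorem (p. 409)] [cite: GreenbergVatsal2000, p. 2, (2)] -/
theorem chiBranchLowerDivisibilityAt_of_baseChange_of_hasUnitContent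
    (hkato : ∀ (V : WeierstrassCurve ℚ) [V.IsElliptic] [V.IsGloballyMinimal] (κ : ZpExtension ℚ p)
      (γ : Field.absoluteGaloisGroup ℚ) (N : ℕ) [NeZero N] (f : CuspForm (Gamma0 N) 2),
      kato_divisibility V p (κ := κ) (γ := γ) (f := f))
    (hR : ∀ (V : WeierstrassCurve ℚ) [V.IsElliptic] [V.IsGloballyMinimal] (N : ℕ) [NeZero N]
      (f : CuspForm (Gamma0 N) 2), padicLFunction_ne_zero (W := V) (p := p) (f := f))
    (hT : ∀ (κ : ZpExtension ℚ p) (γ : Field.absoluteGaloisGroup ℚ) (D : W.SelmerDualData κ γ),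
      κ.IsCyclotomic → κ.IsTopGenerator γ → D.IsTorsion)
    (hBC : GordTwistBaseChangeLowerEvenAt W p)
    (hU : ∀ (V : WeierstrassCurve ℚ) [V.IsElliptic] [V.IsGloballyMinimal] {N : ℕ} [NeZero N]
      (f : CuspForm (Gamma0 N) 2) (ϖ : ℚ), (∃ C : VariableChange ℚ, C • V.quadraticTwist (p : ℚ) = W) →
      GoodOrd V p → IsNewformOf V f → (ϖ : ℝ) * V.realPeriodRat = plusPeriod f →
      ∃ b : IwasawaAlgebra p, iwasawaToPowerSeries p b =
        PowerSeries.C ((ϖ : ℚ) : ℚ_[p]) * padicLFunctionBranch f (unitRoot V p : ℚ_[p]) (p / 2) ∧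
        HasUnitContent b) :
    ChiBranchLowerDivisibilityAt W p := by
  intro V _ _ κ γ N _ f hp1 hCW hV hκ hγ hγ' hf D ϖ hϖ g hg
  have hp2 : p ≠ 2 := by rintro rfl; norm_num at hp1
  have hUV := hU V f ϖ hCW hV hf hϖ
  obtain ⟨C, hCW'⟩ := hCW
  let DV : V.SelmerDualData κ γ := V.selmerDualData κ hγ
  obtain ⟨hVt, hKV, -⟩ := hkato V κ γ N f hp2 hV hκ hγ hγ' hf DV
  exact exists_eq_mul_branch_of_baseChange_of_hasUnitContent hBC V hV hCW' hf hκ hγ hγ' DV hVt hKV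
    (hR V N f hV hf) D (hT κ γ D hκ hγ) ϖ hϖ hUV g hg

/-- **`ChiBranchLowerDivisibilityOddAt W p` (item 19498's input at the pair) from the descended
twist-field road, for ANY image** — odd twin (`p ≡ 3 (mod 4)`, `p = 3` included).
[cite: Kato2004Asterisque, Thm. 17.4 (1)(2) (p. 273)] [cite: RohrlichInventiones1984, Theorem (p. 409)]
[cite: GreenbergVatsal2000, p. 2, (2)] -/
theorem chiBranchLowerDivisibilityOddAt_of_baseChangeOdd_of_hasUnitContent
    (hkato : ∀ (V : WeierstrassCurve ℚ) [V.IsElliptic] [V.IsGloballyMinimal] (κ : ZpExtension ℚ p)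
      (γ : Field.absoluteGaloisGroup ℚ) (N : ℕ) [NeZero N] (f : CuspForm (Gamma0 N) 2),
      kato_divisibility V p (κ := κ) (γ := γ) (f := f))
    (hR : ∀ (V : WeierstrassCurve ℚ) [V.IsElliptic] [V.IsGloballyMinimal] (N : ℕ) [NeZero N]
      (f : CuspForm (Gamma0 N) 2), padicLFunction_ne_zero (W := V) (p := p) (f := f))
    (hT : ∀ (κ : ZpExtension ℚ p) (γ : Field.absoluteGaloisGroup ℚ) (D : W.SelmerDualData κ γ),
      κ.IsCyclotomic → κ.IsTopGenerator γ → D.IsTorsion)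
    (hBC : GordTwistBaseChangeLowerOddAt W p)
    (hU : ∀ (V : WeierstrassCurve ℚ) [V.IsElliptic] [V.IsGloballyMinimal] {N : ℕ} [NeZero N]
      (f : CuspForm (Gamma0 N) 2) (ϖ : ℚ),
      (∃ C : VariableChange ℚ, C • V.quadraticTwist (-(p : ℚ)) = W) →
      GoodOrd V p → IsNewformOf V f → (ϖ : ℝ) * V.imaginaryPeriodRat = minusPeriod f →
      ∃ b : IwasawaAlgebra p, iwasawaToPowerSeries p b =
        PowerSeries.C ((ϖ : ℚ) : ℚ_[p]) * padicLFunctionMinusBranch f (unitRoot V p : ℚ_[p]) (p / 2) ∧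
        HasUnitContent b) :
    ChiBranchLowerDivisibilityOddAt W p := by
  intro V _ _ κ γ N _ f hp3 hCW hV hκ hγ hγ' hf D ϖ hϖ g hg
  have hp2 : p ≠ 2 := by rintro rfl; norm_num at hp3
  have hUV := hU V f ϖ hCW hV hf hϖ
  obtain ⟨C, hCW'⟩ := hCW
  let DV : V.SelmerDualData κ γ := V.selmerDualData κ hγ
  obtain ⟨hVt, hKV, -⟩ := hkato V κ γ N f hp2 hV hκ hγ hγ' hf DV
  exact exists_eq_mul_minusBranch_of_baseChangeOdd_of_hasUnitContent hBC V hV hCW' hf hκ hγ hγ' DV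
    hVt hKV (hR V N f hV hf) D (hT κ γ D hκ hγ) ϖ hϖ hUV g hg

end Currency

/-! ## §6 Comparison with gen 0's K-level (tower, integral) input: (TF) ⟹ (BC-Gord); and the rational
«no free lunch» (BC-Gord) ⟸ rational lower for `V` ∧ rational branch lower for `W` -/

section Compare

variable {W : WeierstrassCurve ℚ} [W.IsElliptic] {p : ℕ} [hp : Fact p.Prime]

/-- **(TF) ⟹ (BC-Gord), even.** The integral K-level containment `TwistFieldLowerDivisibilityEvenAt V p`
for the good ordinary twist models `V` of `W` (gen 0's input, over the tower datum `X(V/K·ℚ_∞)`,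
`K = ℚ(√p)`) implies the descended product bound `GordTwistBaseChangeLowerEvenAt W p` — with `m = n` the
exponent of boundedness of `𝓛 = L_p(f,α,T)·ϖ·L_p(f,α,ω^{(p−1)/2},T)` (`MemIwasawaRat`, displayed:
Mazur–Tate–Teitelbaum §I.12–I.13, bounded measures) and `G = p^n·𝓛`. Mechanism: realise `K ⊂ ℚ(ζ_p)`,
normalise the generator into `Gal(ℚ̄/K)` (additive-p1), re-label both dual data (`congrGen`), and use
`char X(V/K·ℚ_∞) = char X(V/ℚ_∞)·char X(W/ℚ_∞)` (this lane, `charIdeal_towerDual_eq_mul`).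
[cite: MazurTateTeitelbaum1986Invent, §I.12–I.13] [cite: GreenbergLNM1716, §1 p. 60, §5 p. 143] -/
theorem gordTwistBaseChangeLowerEvenAt_of_twistField (hp1 : p % 4 = 1)
    (hTF : ∀ (V : WeierstrassCurve ℚ) [V.IsElliptic] [V.IsGloballyMinimal],
      (∃ C : VariableChange ℚ, C • V.quadraticTwist (p : ℚ) = W) → GoodOrd V p →
        TwistFieldLowerDivisibilityEvenAt V p)
    (hbdd : ∀ (V : WeierstrassCurve ℚ) [V.IsElliptic] [V.IsGloballyMinimal] {N : ℕ} [NeZero N]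
      (f : CuspForm (Gamma0 N) 2) (ϖ : ℚ), (∃ C : VariableChange ℚ, C • V.quadraticTwist (p : ℚ) = W) →
      GoodOrd V p → IsNewformOf V f →
      MemIwasawaRat p (padicLFunction f (unitRoot V p : ℚ_[p]) *
        (PowerSeries.C ((ϖ : ℚ) : ℚ_[p]) * padicLFunctionBranch f (unitRoot V p : ℚ_[p]) (p / 2)))) :
    GordTwistBaseChangeLowerEvenAt W p := by
  intro V _ _ C hV hCW N _ f hf κ γ hκ hγ hγ' DV D ϖ hVt hDt hϖ
  obtain ⟨n, G, hG⟩ := hbdd V f ϖ ⟨C, hCW⟩ hV hf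
  refine ⟨n, n, G, hG.symm, fun x hx y hy ↦ ?_⟩
  have hp2 : p ≠ 2 := by rintro rfl; norm_num at hp1
  have hpne : (p : ℚ) ≠ 0 := Nat.cast_ne_zero.mpr hp.out.ne_zero
  haveI : (V.quadraticTwist (p : ℚ)).IsElliptic := V.isElliptic_quadraticTwist hpne
  -- realise `K = ℚ(√p)` inside `ℚ(ζ_p)`
  haveI hcycL : IsCyclotomicExtension {p} ℚ (CyclotomicField p ℚ) := by
    have h : (CyclotomicField.algebra p ℚ : Algebra ℚ (CyclotomicField p ℚ)) =
        DivisionRing.toRatAlgebra := Subsingleton.elim _ _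
    exact h ▸ CyclotomicField.isCyclotomicExtension p ℚ
  obtain ⟨K, θ, hK2, hθ, hθ2⟩ := exists_intermediateField_sq_eq_pStar p (CyclotomicField p ℚ) hp2
  haveI : NumberField K := NumberField.of_module_finite ℚ K
  have hcK : θ ^ 2 = algebraMap ℚ K (p : ℚ) := by
    rw [hθ2, pStar_eq_self_of_mod_four_eq_one hp1]
  haveI : IsGalois ℚ K := isGalois_of_finrank_eq_two K hK2
  haveI := normal_galRange K hK2 (sigmaQ_ne_one K hK2 hθ hcK)
  -- normalise the generator into `Gal(ℚ̄/K)` and move both data there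
  obtain ⟨g₀, hg₀, hγK, hWconj, -⟩ := exists_mul_mem_galRange W K hK2 hθ hcK κ hp2 γ
  have hVconj := conjH1_mul_of_mem_kerSubgroup V κ γ hg₀
  have hγ₁ : κ.IsTopGenerator (γ * g₀) := isTopGenerator_mul_of_mem_kerSubgroup κ hγ hg₀
  have hγ₁' : IsCyclotomicVariable p (γ * g₀) := isCyclotomicVariable_mul_of_mem_kerSubgroup κ hκ hg₀ hγ'
  let D₁ : W.SelmerDualData κ (γ * g₀) :=
    Summit.BirchSwinnertonDyer.Rank1Residual.AdditivePotMult.SelmerDualData.congrGen W κ hWconj D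
  let DV₁ : V.SelmerDualData κ (γ * g₀) :=
    Summit.BirchSwinnertonDyer.Rank1Residual.AdditivePotMult.SelmerDualData.congrGen V κ hVconj DV
  let DK : TowerSelmerDualData V κ K (γ * g₀) :=
    towerSelmerDualData V κ K (kappa_surjOn_galRange K hK2 p κ hp2) hγ₁ hγK
  haveI : Module.Finite (IwasawaAlgebra p) DV₁.X :=
    SelmerDualData.module_finite_of_isCyclotomic V κ hκ DV₁ hγ₁
  haveI : Module.Finite (IwasawaAlgebra p) D₁.X :=
    SelmerDualData.module_finite_of_isCyclotomic W κ hκ D₁ hγ₁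
  have hprod := charIdeal_towerDual_eq_mul V K hK2 hθ hcK p κ hCW hγ₁ hγK hp2 DK DV₁ D₁ hVt hDt
  have hmem : x * y ∈
      Literature.NumberTheory.EllipticCurves.Module.charIdeal (IwasawaAlgebra p) DK.X := by
    rw [hprod]; exact Ideal.mul_mem_mul hx hy
  obtain ⟨h, hh⟩ :=
    hTF V ⟨C, hCW⟩ hV K θ hp1 hK2 hθ hcK hV hκ hγ₁ hγ₁' hγK hf DK ϖ hϖ (x * y) hmem
  refine Ideal.mem_span_singleton'.mpr ⟨h, iwasawaToPowerSeries_injective p ?_⟩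
  rw [map_mul, map_mul, hh, ← hG, iwasawaToPowerSeries_C_natCast_pow p]
  ring

/-- **(TF) ⟹ (BC-Gord), odd** (`p ≡ 3 (mod 4)`, `p = 3` included; `K = ℚ(√−p) ⊂ ℚ(ζ_p)`).
[cite: MazurTateTeitelbaum1986Invent, §I.12–I.13] [cite: GreenbergLNM1716, §1 p. 60, §5 p. 143] -/
theorem gordTwistBaseChangeLowerOddAt_of_twistFieldOdd (hp3 : p % 4 = 3)
    (hTF : ∀ (V : WeierstrassCurve ℚ) [V.IsElliptic] [V.IsGloballyMinimal],
      (∃ C : VariableChange ℚ, C • V.quadraticTwist (-(p : ℚ)) = W) → GoodOrd V p →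
        TwistFieldLowerDivisibilityOddAt V p)
    (hbdd : ∀ (V : WeierstrassCurve ℚ) [V.IsElliptic] [V.IsGloballyMinimal] {N : ℕ} [NeZero N]
      (f : CuspForm (Gamma0 N) 2) (ϖ : ℚ), (∃ C : VariableChange ℚ, C • V.quadraticTwist (-(p : ℚ)) = W) →
      GoodOrd V p → IsNewformOf V f →
      MemIwasawaRat p (padicLFunction f (unitRoot V p : ℚ_[p]) *
        (PowerSeries.C ((ϖ : ℚ) : ℚ_[p]) * padicLFunctionMinusBranch f (unitRoot V p : ℚ_[p]) (p / 2)))) :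
    GordTwistBaseChangeLowerOddAt W p := by
  intro V _ _ C hV hCW N _ f hf κ γ hκ hγ hγ' DV D ϖ hVt hDt hϖ
  obtain ⟨n, G, hG⟩ := hbdd V f ϖ ⟨C, hCW⟩ hV hf
  refine ⟨n, n, G, hG.symm, fun x hx y hy ↦ ?_⟩
  have hp2 : p ≠ 2 := by rintro rfl; norm_num at hp3
  have hpne : (-(p : ℚ)) ≠ 0 := neg_ne_zero.mpr (Nat.cast_ne_zero.mpr hp.out.ne_zero)
  haveI : (V.quadraticTwist (-(p : ℚ))).IsElliptic := V.isElliptic_quadraticTwist hpne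
  haveI hcycL : IsCyclotomicExtension {p} ℚ (CyclotomicField p ℚ) := by
    have h : (CyclotomicField.algebra p ℚ : Algebra ℚ (CyclotomicField p ℚ)) =
        DivisionRing.toRatAlgebra := Subsingleton.elim _ _
    exact h ▸ CyclotomicField.isCyclotomicExtension p ℚ
  obtain ⟨K, θ, hK2, hθ, hθ2⟩ := exists_intermediateField_sq_eq_pStar p (CyclotomicField p ℚ) hp2
  haveI : NumberField K := NumberField.of_module_finite ℚ K
  have hcK : θ ^ 2 = algebraMap ℚ K (-(p : ℚ)) := by
    rw [hθ2, pStar_eq_neg_of_mod_four_eq_three hp3]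
  haveI : IsGalois ℚ K := isGalois_of_finrank_eq_two K hK2
  haveI := normal_galRange K hK2 (sigmaQ_ne_one K hK2 hθ hcK)
  obtain ⟨g₀, hg₀, hγK, hWconj, -⟩ := exists_mul_mem_galRange W K hK2 hθ hcK κ hp2 γ
  have hVconj := conjH1_mul_of_mem_kerSubgroup V κ γ hg₀
  have hγ₁ : κ.IsTopGenerator (γ * g₀) := isTopGenerator_mul_of_mem_kerSubgroup κ hγ hg₀
  have hγ₁' : IsCyclotomicVariable p (γ * g₀) := isCyclotomicVariable_mul_of_mem_kerSubgroup κ hκ hg₀ hγ'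
  let D₁ : W.SelmerDualData κ (γ * g₀) :=
    Summit.BirchSwinnertonDyer.Rank1Residual.AdditivePotMult.SelmerDualData.congrGen W κ hWconj D
  let DV₁ : V.SelmerDualData κ (γ * g₀) :=
    Summit.BirchSwinnertonDyer.Rank1Residual.AdditivePotMult.SelmerDualData.congrGen V κ hVconj DV
  let DK : TowerSelmerDualData V κ K (γ * g₀) :=
    towerSelmerDualData V κ K (kappa_surjOn_galRange K hK2 p κ hp2) hγ₁ hγK
  haveI : Module.Finite (IwasawaAlgebra p) DV₁.X :=
    SelmerDualData.module_finite_of_isCyclotomic V κ hκ DV₁ hγ₁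
  haveI : Module.Finite (IwasawaAlgebra p) D₁.X :=
    SelmerDualData.module_finite_of_isCyclotomic W κ hκ D₁ hγ₁
  have hprod := charIdeal_towerDual_eq_mul V K hK2 hθ hcK p κ hCW hγ₁ hγK hp2 DK DV₁ D₁ hVt hDt
  have hmem : x * y ∈
      Literature.NumberTheory.EllipticCurves.Module.charIdeal (IwasawaAlgebra p) DK.X := by
    rw [hprod]; exact Ideal.mul_mem_mul hx hy
  obtain ⟨h, hh⟩ :=
    hTF V ⟨C, hCW⟩ hV K θ hp3 hK2 hθ hcK hV hκ hγ₁ hγ₁' hγK hf DK ϖ hϖ (x * y) hmem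
  refine Ideal.mem_span_singleton'.mpr ⟨h, iwasawaToPowerSeries_injective p ?_⟩
  rw [map_mul, map_mul, hh, ← hG, iwasawaToPowerSeries_C_natCast_pow p]
  ring

/-- **Rational «no free lunch», abstract** (any `L`, `B`): if `char X(V/ℚ_∞) = (x₀)` with
`p^{k₁}·ι x₀ = ι h₁·L` (a RATIONAL Skinner–Urban containment for `V` on the trivial branch),
`char X(W/ℚ_∞) = (y₀)` with `p^{k₂}·ι y₀ = ι h₂·B` (a RATIONAL branch containment for `W`) and
`p^n·(L·B) = ι G` (boundedness), then `p^{k₁+k₂+n}·(x·y) ∈ (G)` for all `x ∈ (x₀)`, `y ∈ (y₀)` — the product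
clause of (BC-Gord) with `m = k₁ + k₂ + n`. So the descended input is, modulo Kato (2) and Rohrlich, the
conjunction of the two RATIONAL `ℚ`-level containments: it re-bases the missing theorem, it does not
shrink it (the gen-0 verdict, rational version). [folklore] -/
theorem C_pow_mul_mem_span_of_rational_lower {k₁ k₂ n : ℕ} {x₀ y₀ h₁ h₂ G x y : IwasawaAlgebra p}
    {L B : PowerSeries ℚ_[p]}
    (h1 : PowerSeries.C ((p : ℚ_[p]) ^ k₁) * iwasawaToPowerSeries p x₀ = iwasawaToPowerSeries p h₁ * L)
    (h2 : PowerSeries.C ((p : ℚ_[p]) ^ k₂) * iwasawaToPowerSeries p y₀ = iwasawaToPowerSeries p h₂ * B)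
    (hG : PowerSeries.C ((p : ℚ_[p]) ^ n) * (L * B) = iwasawaToPowerSeries p G)
    (hx : x ∈ Ideal.span {x₀}) (hy : y ∈ Ideal.span {y₀}) :
    PowerSeries.C ((p : ℤ_[p]) ^ (k₁ + k₂ + n)) * (x * y) ∈ Ideal.span {G} := by
  obtain ⟨a, rfl⟩ := Ideal.mem_span_singleton'.mp hx
  obtain ⟨b, rfl⟩ := Ideal.mem_span_singleton'.mp hy
  refine Ideal.mem_span_singleton'.mpr ⟨a * b * h₁ * h₂, iwasawaToPowerSeries_injective p ?_⟩
  have hιC : iwasawaToPowerSeries p (PowerSeries.C ((p : ℤ_[p]) ^ (k₁ + k₂ + n))) =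
      PowerSeries.C ((p : ℚ_[p]) ^ k₁) * PowerSeries.C ((p : ℚ_[p]) ^ k₂) *
        PowerSeries.C ((p : ℚ_[p]) ^ n) := by
    rw [iwasawaToPowerSeries_C_natCast_pow p, pow_add, pow_add, map_mul, map_mul]
  simp only [map_mul]
  rw [hιC, ← hG]
  linear_combination (-(iwasawaToPowerSeries p a * iwasawaToPowerSeries p b)) *
    (PowerSeries.C ((p : ℚ_[p]) ^ n) * (iwasawaToPowerSeries p y₀ * PowerSeries.C ((p : ℚ_[p]) ^ k₂) * h1 +
      iwasawaToPowerSeries p h₁ * L * h2))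

end Compare

end Summit.BirchSwinnertonDyer.BirchSwinnertonDyer.Theorems.AdditiveBranchIMCTwistField

end
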